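import Summits.QuantumFields.BalabanUV.T4Continuum.Support.NE3StraightAverageAdjoint
import HarnessLib

/-!
# T⁴ programme, node NE3 — row E-MLw-(w4)-P, flat file F1 (part 2): THE SPLIT `Wad = ∂_κ hsp + Jmp` OF THE ADJOINT WEIGHTS,
# periodic summation by parts in one direction, and THE FACE JUMP OF AN EXACT COARSE FORM IS A FINE GAUGE MODE (Landau kills it)

NE3 (node U1b), row NE3 OWNER `b2b-balaban-t4-ne3-p1` (gen 21), design ruling D-ne3p1-g21-1 (journal l.15420) §1 (II)–(V);
part 1 is `NE3StraightAverageAdjoint` (the torus adjoint identity `Σ_z ⟪ω, T⟫ = Σ_x ⟪Wad ω, Y⟫`).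

CONTENT ([folklore]; 0 sorry; data defs `αw`, `γw` (quadratic B-spline weights), `hsp`, `Jmp`; no `def … : Prop`):
§4 **`Wad_eq`**: `Wad M ω x κ = hsp M ω (x + e_κ) κ − hsp M ω x κ + Jmp M ω x κ` for ANY coarse form `ω` (pure residue
   algebra), with `hsp M ω x κ = α(r_κ)•ω(z) κ − γ_M(r_κ)•ω(z − e_κ) κ`, `α(r) = r(r+1)∕2`, `γ_M(r) = (M−1−r)(M−r)∕2`, and the
   FACE JUMP `Jmp M ω x κ = [r_κ = M−1]·M²•ω(z) κ`; **`norm_hsp_le`**: `‖hsp‖ ≤ (M²∕2)(‖ω(z) κ‖ + ‖ω(z−e_κ) κ‖)` — only VALUES of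
   `ω` appear, never a potential of `ω`;
§5 **`sum_inner_fd_eq_neg`** (periodic summation by parts in the direction `κ`, real inner product), `hsp_periodic`,
   **`Jmp_dPot`**: `Jmp M (dPot μ) = M²•dPot (μ ∘ cdiv M)` (the block-constant extension), and
   **`sum_inner_Jmp_dPot_eq_zero`**: `Σ_x Σ_κ ⟪Jmp M (dPot μ) x κ, Y x κ⟫ = 0` whenever `Σ_κ (Y x κ − Y (x−e_κ) κ) = 0` at every
   site — the ONLY place where exactness of the straight average and the Landau condition enter the (w4)-P chain.

HONEST FRAMING.  Lattice combinatorics of OUR frame at the FLAT configuration; nothing about Bałaban's minimisers, (P_W),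
(ML_w), T-E_w or NE3 is asserted; NE3 NOT proved; spine PROVED 0∕9; finite T⁴ rung (B)+1 — NOT infinite volume, NOT mass gap,
NOT BetaPertH, NOT Clay.  ABSOLUTE RULE kept (nothing printed is a hypothesis; context only: [Balaban1985Averaging] (122)∕(125)
p. 36).  PLACEMENT: `Summits/QuantumFields/BalabanUV/`; imports part 1 only.
-/

set_option autoImplicit false

open scoped BigOperators InnerProductSpace
open Finset

namespace Summit.QuantumFields.BalabanUV.T4Continuum.NE3StraightAverageSplit

open Literature.MathematicalPhysics.QuantumFieldTheory.Balaban1983to89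
open B7Prop1Explicit
open T4AveragingDeficitWallBoundary (periodBox mem_periodBox)
open NE3TangentNoGoWords (dPot)
open NE3CoarseTorusExact (sum_periodBox_add_e)
open SkeletonLattice (cdiv cmod cmod_nonneg cmod_lt cdiv_add_period cmod_add_period)
open NE3StraightAverageAdjoint (Wad cdiv_add_e_of_ne cmod_add_e_of_ne cdiv_add_e_of_eq cmod_add_e_of_eq)

noncomputable section

variable {d : ℕ}

/-! ## §4 The split `Wad = ∂_κ hsp + Jmp` -/

section Split

variable {V : Type*} [AddCommGroup V] [Module ℝ V]

/-- Quadratic-spline weight of the forward neighbour: `α(r) = r(r+1)∕2`. [folklore] -/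
def αw (r : ℝ) : ℝ := r * (r + 1) / 2

/-- Quadratic-spline weight of the backward neighbour: `γ_M(r) = (M−1−r)(M−r)∕2`. [folklore] -/
def γw (M : ℕ) (r : ℝ) : ℝ := ((M : ℝ) - 1 - r) * ((M : ℝ) - r) / 2

/-- **THE SPLINE CORRECTION** `hsp M ω x κ := α(r_κ(x))•ω(z(x)) κ − γ_M(r_κ(x))•ω(z(x) − e_κ) κ` — the quadratic B-spline
antiderivative of `Wad ω` along `κ` MINUS `M²·` the block-constant extension (so that only VALUES of `ω`, never a potential of
`ω`, appear). [folklore] -/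
def hsp (M : ℕ) (ω : Site d → Fin d → V) (x : Site d) (κ : Fin d) : V :=
  αw ((cmod M x κ : ℤ) : ℝ) • ω (cdiv M x) κ - γw M ((cmod M x κ : ℤ) : ℝ) • ω (cdiv M x - e κ) κ

/-- **THE FACE JUMP** `Jmp M ω x κ := [r_κ(x) = M − 1]·M²•ω(z(x)) κ` (supported on the bonds crossing a block face). [folklore] -/
def Jmp (M : ℕ) (ω : Site d → Fin d → V) (x : Site d) (κ : Fin d) : V :=
  if cmod M x κ = (M : ℤ) - 1 then ((M : ℝ) ^ 2) • ω (cdiv M x) κ else 0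

/-- **THE SPLIT**: `Wad M ω x κ = hsp M ω (x + e_κ) κ − hsp M ω x κ + Jmp M ω x κ` (pure residue algebra, ANY `ω`).
[folklore] -/
theorem Wad_eq {M : ℕ} (hM : 1 ≤ M) (ω : Site d → Fin d → V) (x : Site d) (κ : Fin d) :
    Wad M ω x κ = hsp M ω (x + e κ) κ - hsp M ω x κ + Jmp M ω x κ := by
  by_cases h : cmod M x κ = (M : ℤ) - 1
  · -- face bond: the block index advances, the residue wraps to 0
    have hc := cdiv_add_e_of_eq hM h
    have hm : cmod M (x + e κ) κ = 0 := by
      rw [cmod_add_e_of_eq hM h]; simp [e_apply, h]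
    have hr : ((cmod M x κ : ℤ) : ℝ) = (M : ℝ) - 1 := by rw [h]; push_cast; ring
    simp only [Wad, hsp, Jmp, if_pos h, hc, hm, hr, add_sub_cancel_right, Int.cast_zero, αw, γw]
    module
  · -- interior bond: same block, residue + 1
    have hc := cdiv_add_e_of_ne hM h
    have hm : ((cmod M (x + e κ) κ : ℤ) : ℝ) = ((cmod M x κ : ℤ) : ℝ) + 1 := by
      rw [cmod_add_e_of_ne hM h]; simp [e_apply]
    simp only [Wad, hsp, Jmp, if_neg h, hc, hm, αw, γw, add_zero]
    module

/-- The spline weights are bounded by `M²∕2` on `[0, M)`. [folklore] -/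
theorem αw_nonneg_le {M : ℕ} {r : ℝ} (h0 : 0 ≤ r) (hM : r ≤ (M : ℝ) - 1) :
    0 ≤ αw r ∧ αw r ≤ (M : ℝ) ^ 2 / 2 := by
  refine ⟨by unfold αw; positivity, ?_⟩
  unfold αw
  have : r * (r + 1) ≤ (M : ℝ) ^ 2 := by nlinarith
  linarith

/-- The spline weights are bounded by `M²∕2` on `[0, M)`. [folklore] -/
theorem γw_nonneg_le {M : ℕ} {r : ℝ} (h0 : 0 ≤ r) (hM : r ≤ (M : ℝ) - 1) :
    0 ≤ γw M r ∧ γw M r ≤ (M : ℝ) ^ 2 / 2 := by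
  unfold γw
  have h1 : 0 ≤ (M : ℝ) - 1 - r := by linarith
  have h2 : 0 ≤ (M : ℝ) - r := by linarith
  refine ⟨by positivity, ?_⟩
  have : ((M : ℝ) - 1 - r) * ((M : ℝ) - r) ≤ (M : ℝ) ^ 2 := by nlinarith
  linarith

end Split

section SplitNorm

variable {F : Type*} [NormedAddCommGroup F] [NormedSpace ℝ F]

/-- **SIZE OF THE SPLINE CORRECTION**: `‖hsp M ω x κ‖ ≤ (M²∕2)·(‖ω(z(x)) κ‖ + ‖ω(z(x) − e_κ) κ‖)`. [folklore] -/
theorem norm_hsp_le {M : ℕ} (hM : 1 ≤ M) (ω : Site d → Fin d → F) (x : Site d) (κ : Fin d) :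
    ‖hsp M ω x κ‖ ≤ (M : ℝ) ^ 2 / 2 * (‖ω (cdiv M x) κ‖ + ‖ω (cdiv M x - e κ) κ‖) := by
  have h0 : (0 : ℝ) ≤ ((cmod M x κ : ℤ) : ℝ) := by exact_mod_cast cmod_nonneg (L := M) hM x κ
  have h1 : ((cmod M x κ : ℤ) : ℝ) ≤ (M : ℝ) - 1 := by
    have := cmod_lt (L := M) hM x κ
    have : (cmod M x κ : ℤ) ≤ (M : ℤ) - 1 := by omega
    exact_mod_cast this
  obtain ⟨ha0, ha⟩ := αw_nonneg_le (M := M) h0 h1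
  obtain ⟨hg0, hg⟩ := γw_nonneg_le (M := M) h0 h1
  unfold hsp
  refine (norm_sub_le _ _).trans ?_
  rw [norm_smul, norm_smul, Real.norm_of_nonneg ha0, Real.norm_of_nonneg hg0, mul_add]
  exact add_le_add (mul_le_mul_of_nonneg_right ha (norm_nonneg _)) (mul_le_mul_of_nonneg_right hg (norm_nonneg _))

end SplitNorm

/-! ## §5 Periodic summation by parts in one direction; the face jump of an exact form is a gauge mode -/

section Parts

variable {E : Type*} [NormedAddCommGroup E] [InnerProductSpace ℝ E]

/-- **PERIODIC SUMMATION BY PARTS IN THE DIRECTION `κ`**: for `P`-periodic `φ`, `y`,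
`Σ_{x∈periodBox P} ⟪φ(x+e_κ) − φ x, y x⟫ = −Σ_x ⟪φ x, y x − y(x − e_κ)⟫`. [folklore] -/
theorem sum_inner_fd_eq_neg {P : ℕ} (hP : 1 ≤ P) (κ : Fin d) (φ y : Site d → E)
    (hφ : ∀ (x : Site d) (τ : Fin d), φ (x + (P : ℤ) • e τ) = φ x)
    (hy : ∀ (x : Site d) (τ : Fin d), y (x + (P : ℤ) • e τ) = y x) :
    ∑ x ∈ periodBox (d := d) P, ⟪φ (x + e κ) - φ x, y x⟫_ℝ
      = -∑ x ∈ periodBox (d := d) P, ⟪φ x, y x - y (x - e κ)⟫_ℝ := by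
  simp_rw [inner_sub_left]
  rw [sum_sub_distrib]
  have hper : ∀ (x : Site d) (τ : Fin d), ⟪φ (x + (P : ℤ) • e τ), y (x + (P : ℤ) • e τ - e κ)⟫_ℝ = ⟪φ x, y (x - e κ)⟫_ℝ := by
    intro x τ
    rw [hφ, add_sub_right_comm, hy]
  have h := sum_periodBox_add_e hP (g := fun x => ⟪φ x, y (x - e κ)⟫_ℝ) hper κ
  simp only [add_sub_cancel_right] at h
  rw [h, ← sum_sub_distrib, ← sum_neg_distrib]
  refine sum_congr rfl fun x _ => ?_
  rw [inner_sub_right]; ring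

/-- `hsp` of an `N`-periodic coarse form is `M·N`-periodic. [folklore] -/
theorem hsp_periodic {M : ℕ} (hM : 1 ≤ M) {N : ℕ} (ω : Site d → Fin d → E)
    (hω : ∀ (z : Site d) (τ μ : Fin d), ω (z + (N : ℤ) • e τ) μ = ω z μ) (x : Site d) (τ κ : Fin d) :
    hsp M ω (x + ((M * N : ℕ) : ℤ) • e τ) κ = hsp M ω x κ := by
  have hc := cdiv_add_period (L := M) hM (N : ℤ) x τ
  have hm := cmod_add_period (L := M) (N : ℤ) x τ
  push_cast at hc hm ⊢
  simp only [hsp, hc, hm]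
  rw [hω, add_sub_right_comm, hω]

/-- The block-constant extension `μ ∘ cdiv M` of an `N`-periodic coarse function is `M·N`-periodic. [folklore] -/
theorem comp_cdiv_periodic {X : Type*} {M : ℕ} (hM : 1 ≤ M) {N : ℕ} (μ : Site d → X)
    (hμ : ∀ (z : Site d) (τ : Fin d), μ (z + (N : ℤ) • e τ) = μ z) (x : Site d) (τ : Fin d) :
    (μ ∘ cdiv M) (x + ((M * N : ℕ) : ℤ) • e τ) = (μ ∘ cdiv M) x := by
  have hc := cdiv_add_period (L := M) hM (N : ℤ) x τ
  push_cast at hc ⊢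
  simp only [Function.comp_apply, hc, hμ]

/-- **THE FACE JUMP OF AN EXACT COARSE FORM IS `M²·` A FINE GAUGE MODE** (complex values):
`Jmp M (dPot μ) x κ = M²•dPot (μ ∘ cdiv M) x κ`. [folklore] -/
theorem Jmp_dPot {M : ℕ} (hM : 1 ≤ M) (μ : Site d → ℂ) (x : Site d) (κ : Fin d) :
    Jmp M (dPot μ) x κ = ((M : ℝ) ^ 2) • dPot (μ ∘ cdiv M) x κ := by
  unfold Jmp
  by_cases h : cmod M x κ = (M : ℤ) - 1
  · rw [if_pos h]
    simp only [dPot, Function.comp_apply, cdiv_add_e_of_eq hM h]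
  · rw [if_neg h]
    simp only [dPot, Function.comp_apply, cdiv_add_e_of_ne hM h, sub_self, smul_zero]

/-- **THE FACE JUMP OF AN EXACT FORM PAIRS TO ZERO AGAINST A FLAT-DIVERGENCE-FREE FIELD** (complex values): for an
`N`-periodic coarse `μ` and an `M·N`-periodic fine `Y` with `Σ_κ (Y x κ − Y (x − e_κ) κ) = 0` at every site,
`Σ_{x∈periodBox (M·N)} Σ_κ ⟪Jmp M (dPot μ) x κ, Y x κ⟫ = 0`.  The ONLY place where exactness of the straight average and the Landau
condition enter the (w4)-P chain; `μ` itself is never estimated. [folklore] -/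
theorem sum_inner_Jmp_dPot_eq_zero {M : ℕ} (hM : 1 ≤ M) {N : ℕ} (hN : 1 ≤ N) (μ : Site d → ℂ) (Y : Site d → Fin d → ℂ)
    (hμ : ∀ (z : Site d) (τ : Fin d), μ (z + (N : ℤ) • e τ) = μ z)
    (hY : ∀ (x : Site d) (τ μ' : Fin d), Y (x + ((M * N : ℕ) : ℤ) • e τ) μ' = Y x μ')
    (hdiv : ∀ x : Site d, ∑ κ : Fin d, (Y x κ - Y (x - e κ) κ) = 0) :
    ∑ x ∈ periodBox (d := d) (M * N), ∑ κ : Fin d, ⟪Jmp M (dPot μ) x κ, Y x κ⟫_ℝ = 0 := by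
  have hMN : 1 ≤ M * N := Nat.one_le_iff_ne_zero.mpr (Nat.mul_ne_zero (by omega) (by omega))
  simp_rw [Jmp_dPot hM, real_inner_smul_left]
  rw [sum_comm]
  have hκ : ∀ κ : Fin d, ∑ x ∈ periodBox (d := d) (M * N), (M : ℝ) ^ 2 * ⟪dPot (μ ∘ cdiv M) x κ, Y x κ⟫_ℝ
      = -((M : ℝ) ^ 2 * ∑ x ∈ periodBox (d := d) (M * N), ⟪(μ ∘ cdiv M) x, Y x κ - Y (x - e κ) κ⟫_ℝ) := by
    intro κ
    rw [← mul_sum, ← mul_neg]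
    congr 1
    exact sum_inner_fd_eq_neg hMN κ (μ ∘ cdiv M) (fun x => Y x κ) (comp_cdiv_periodic hM μ hμ)
      (fun x τ => hY x τ κ)
  have hz : ∑ κ : Fin d, ∑ x ∈ periodBox (d := d) (M * N), ⟪(μ ∘ cdiv M) x, Y x κ - Y (x - e κ) κ⟫_ℝ = 0 := by
    rw [sum_comm]
    refine sum_eq_zero fun x _ => ?_
    rw [← inner_sum, hdiv x, inner_zero_right]
  simp_rw [hκ]
  rw [show ∑ κ : Fin d, -((M : ℝ) ^ 2 * ∑ x ∈ periodBox (d := d) (M * N), ⟪(μ ∘ cdiv M) x, Y x κ - Y (x - e κ) κ⟫_ℝ)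
      = -((M : ℝ) ^ 2 * ∑ κ : Fin d, ∑ x ∈ periodBox (d := d) (M * N), ⟪(μ ∘ cdiv M) x, Y x κ - Y (x - e κ) κ⟫_ℝ) by
    rw [mul_sum, ← sum_neg_distrib], hz, mul_zero, neg_zero]

end Parts

end

end Summit.QuantumFields.BalabanUV.T4Continuum.NE3StraightAverageSplit
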